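import Mathlib.FieldTheory.AlgebraicClosure
import Mathlib.GroupTheory.Commutator.Basic
import Literature.AnabelianGeometry.AbsoluteAnabelian.FundamentalExtension
import HarnessLib

/-!
# [AbsTopIII] §1: the model interface `X ↦ (1 → Δ_X → Π_X → G_k → 1)` and Prop. 1.4, Def. 1.7

Mochizuki, *Topics in Absolute Anabelian Geometry III*, §1 (manuscript pages, lit key
`paper:url-5493eb38cbb7`; journal pagination not held).

The statements of §1 from Prop. 1.4 on quantify over hyperbolic (orbi)curves `X` over a field
`k` together with "the natural exact sequence of profinite groups `1 → Δ_U → Π_U → G_k → 1` —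
where we write `Π_U := π₁(U) → G_k := π₁(Spec(k))` for the natural surjection of étale
fundamental groups" (Prop. 1.4 p. 31).  The étale fundamental group of a curve is not in the
tree (plan/FOUNDATIONS.md row 12), so this assignment enters as an INTERFACE `CurveModel`: a
structure recording, for an index type of curves, the base field (a real `Field` of
characteristic zero with `gal ≅ Gal(k̄/k)`), the extension (`FundamentalExtension`), the cusps,
the function field, closed points with decomposition groups, the NF-predicates of Def. 1.7 and
the surjections `Π_U ↠ Π_{U'}` for cofinite opens `U ⊆ U'` (Prop. 1.4).  Every comparison
statement of [AbsTopIII] §1 between "group-theoretic" constructions and scheme theory is then a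
predicate ON A MODEL `M : CurveModel` (typing policy θ of the abc-iut cell, plan/L4/ASSIGNMENTS.md
§2: closed `∃`-statements over "data arising from a curve" are avoided because they are refutable by
junk data; the comparison statements of Thm. 1.9 / Cor. 1.10 are typed in this shape in the sibling
reconstruction files of this directory).  The intended model is the étale `π₁`; nothing here
asserts that a model exists.  `Ẑ`, where needed, is Mathlib's
`ProfiniteGrp.ProfiniteCompletion.completion (GrpCat.of (Multiplicative ℤ))` (as in the tree's
`SemiGraphs.TemperedAnabelian.ZHat`); no further copy is declared here.

Also here: Prop. 1.4 (i), (ii) (the group-theoretic shape of "maximal cuspidally central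
quotients", [Mzk19] Def. 1.1 (i)), Rmk. 1.7.1 (record), Rmk. 1.9.2.
Not typed: the final clause of Prop. 1.4 (ii) (the Leray differential producing
`M_X := Hom(H²(Δ_X, Ẑ), Ẑ) ≅ I_x`), which needs `H²` of profinite groups with `Ẑ`-coefficients.
-/

noncomputable section

open CategoryTheory
open scoped Classical Pointwise

namespace Literature.AnabelianGeometry.AbsoluteAnabelian.AbsTopIII

universe u

/-! ### Prop. 1.4 (ii): the group-theoretic shape of a cuspidally central extension -/

section CuspidallyCentral

variable {E F : FundamentalExtension.{u}}

/-- For a homomorphism of extensions `q : E → F` over the same `G` (a "cuspidal quotient"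
`Π_{U_x} ↠ Π_X`), the *cuspidal kernel* `N := Ker(Δ_E → Δ_F)` as a subgroup of `Π_E`
([AbsTopIII] Prop. 1.4 (ii) p. 31: "`Ker(Q ↠ Δ_X)`"). [cite: MochizukiAbsTopIII2015, Prop 1.4 (ii) p.31] -/
def cuspidalKernel (q : E ⟶ F) : Subgroup E.arith := q.arith.toMonoidHom.ker ⊓ E.geom

/-- The closed subgroup `[N, Δ_E]⁻` by which one divides to obtain "the maximal cuspidally
central quotient of `Δ_{U_x}` [i.e., the maximal intermediate quotient `Δ_{U_x} ↠ Q ↠ Δ_X` such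
that `Ker(Q ↠ Δ_X)` lies in the center of `Q` — cf. [Mzk19], Definition 1.1, (i)]"
([AbsTopIII] Prop. 1.4 (ii) p. 31). [cite: MochizukiAbsTopIII2015, Prop 1.4 (ii) p.31] -/
def cuspidallyCentralModulus (q : E ⟶ F) : Subgroup E.arith :=
  (⁅cuspidalKernel q, E.geom⁆).topologicalClosure

/-- Prop. 1.4 (ii), first display, as a group-theoretic property of a cuspidal quotient
`q : Π_{U_x} ↠ Π_X` and an inertia group `I_x ⊆ Δ_{U_x}`: "we have a natural exact sequence of
profinite groups `1 → I_x → Δ^{c-cn}_{U_x} → Δ_X → 1`", i.e. `I_x` meets `[N, Δ]⁻` trivially and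
`I_x · [N, Δ]⁻ = N` where `N = Ker(Δ_{U_x} ↠ Δ_X)`. [cite: MochizukiAbsTopIII2015, Prop 1.4 (ii) p.31] -/
@[mk_iff] structure IsCuspidallyCentralExtension (q : E ⟶ F) (I : Subgroup E.arith) : Prop where
  /-- `I_x → Δ^{c-cn}` is injective -/
  inf_eq_bot : I ⊓ cuspidallyCentralModulus q = ⊥
  /-- its image is the kernel of `Δ^{c-cn} ↠ Δ_X` -/
  sup_eq : I ⊔ cuspidallyCentralModulus q = cuspidalKernel q

end CuspidallyCentral

/-! ### The model interface (FOUNDATIONS row 12) -/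

/-- INTERFACE for "hyperbolic orbicurves over fields of characteristic zero together with their
arithmetic fundamental groups": the assignment the étale fundamental group would provide (not
constructed in the tree).  `U : M.Curve` stands for a hyperbolic orbicurve `U` over
`k = M.base U` (a real field of characteristic zero); `M.ext U` is "`1 → Δ_U → Π_U → G_k → 1`"
([AbsTopIII] Prop. 1.4 p. 31, Thm. 1.9 p. 37) with "`G_k := Gal(k̄/k)`" via `M.galIso U`;
`M.cusps U` the cuspidal decomposition/inertia groups; `M.FunctionField U = K_U` (p. 29);
`M.Point U`, `M.decomp U` the closed points and their decomposition groups (Cor. 1.10 (e) p. 43);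
`M.IsNFCurve`, `M.IsNFPoint` (Def. 1.7 p. 35); `M.NFFunctionField U = K_{U_NF}` (Thm. 1.9 (d)
p. 37); `M.IsStrictlyBelyiType` ([AbsTopII] Def. 3.5; owner abc-iut-L4-t4, TODO-merge);
`M.IsCofiniteOpen U U'`, `M.res` the surjections `Π_U ↠ Π_{U'}` of Prop. 1.4.  All comparison
facts of [AbsTopIII] §1 are predicates on `M`. [cite: MochizukiAbsTopIII2015, Prop 1.4 p.31] -/
structure CurveModel : Type (u + 2) where
  /-- index type of hyperbolic orbicurves (affine or proper) over fields of characteristic zero -/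
  Curve : Type (u + 1)
  /-- the base field `k` of `U` -/
  base : Curve → Type u
  /-- `k` is a field -/
  [instField : ∀ U, Field (base U)]
  /-- `k` has characteristic zero ("Suppose [...] that `k` is of characteristic zero", p. 31) -/
  [instCharZero : ∀ U, CharZero (base U)]
  /-- "`1 → Δ_U → Π_U → G_k → 1`" -/
  ext : Curve → FundamentalExtension.{u}
  /-- "`G_k := π₁(Spec(k))`" = `Gal(k̄/k)` -/
  galIso : ∀ U, (ext U).gal ≅ absoluteGaloisGrp (base U)
  /-- cuspidal decomposition and inertia groups of `U` (the points of `X ∖ U`) -/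
  cusps : ∀ U, (ext U).CuspidalData
  /-- `U` is proper (`U = X`) -/
  IsProper : Curve → Prop
  /-- `U` is a (scheme-like) curve, not merely an orbicurve -/
  IsScheme : Curve → Prop
  /-- the genus of the compactification `X` of `U` -/
  genus : Curve → ℕ
  /-- the function field `K_U = K_X` (p. 29 "Write `K_X` for the function field of `X`") -/
  FunctionField : Curve → Type u
  /-- `K_U` is a field -/
  [instFunctionField : ∀ U, Field (FunctionField U)]
  /-- `K_U ⊇ k` -/
  [instAlgebra : ∀ U, Algebra (base U) (FunctionField U)]
  /-- the closed points of `U` -/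
  Point : Curve → Type u
  /-- a decomposition group in `Π_U` of a closed point (conjugacy-class representative) -/
  decomp : ∀ U, Point U → Subgroup (ext U).arith
  /-- Def. 1.7 (i) p. 35: "We shall say that `X` is an *NF-curve* if `X_{k̄} := X ×_k k̄` is
  defined over `k̄_NF`" (`k̄_NF` = the algebraic closure of `ℚ` in `k̄`) -/
  IsNFCurve : Curve → Prop
  /-- Def. 1.7 (ii) p. 35: *NF-points* = "points of `X(k̄)` [...] that descend to `k̄_NF`" -/
  IsNFPoint : ∀ U, Point U → Prop
  /-- Def. 1.7 (ii) p. 35: *NF-rational functions* = "rational functions on `X_{k̄}` [...] that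
  descend to `k̄_NF`" (here: those lying in `K_U`) -/
  IsNFRational : ∀ U, FunctionField U → Prop
  /-- Def. 1.7 (ii) p. 35: *NF-constants* = "constant rational functions on `X_{k̄}` [i.e., which
  arise from elements of `k̄`] that descend to `k̄_NF`" (here: those lying in `k`) -/
  IsNFConstant : ∀ U, base U → Prop
  /-- Thm. 1.9 (d) p. 37–38: "`K_{Z_NF}` is the function field of the curve `Z_NF` obtained by
  descending `Z ×_{k_Z} k̄` to `k̄_NF`" (here `Z` = the compactification of `U`; meaningful when
  `IsNFCurve U`) -/
  NFFunctionField : Curve → Type u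
  /-- `K_{Z_NF}` is a field -/
  [instNFFunctionField : ∀ U, Field (NFFunctionField U)]
  /-- [AbsTopII] Def. 3.5 "of strictly Belyi type" (owner abc-iut-L4-t4; TODO-merge) -/
  IsStrictlyBelyiType : Curve → Prop
  /-- `U ⊆ U'` is a dense open with `U' ∖ U` a finite set of closed points and `U`, `U'` have
  the same compactification ("`U ⊆ X` a nonempty open subscheme", "`U_x := X ∖ {x}`", p. 31) -/
  IsCofiniteOpen : Curve → Curve → Prop
  /-- the induced surjection of extensions "`Π_U ↠ Π_{U_x}`" (Prop. 1.4 (i) p. 31) -/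
  res : ∀ {U U' : Curve}, IsCofiniteOpen U U' → (ext U ⟶ ext U')

attribute [instance] CurveModel.instField CurveModel.instCharZero CurveModel.instFunctionField
  CurveModel.instAlgebra CurveModel.instNFFunctionField

namespace CurveModel

variable (M : CurveModel.{u})

/-- "`k̄_NF ⊆ k̄` the algebraic closure of `ℚ` in `k̄`" (Def. 1.7 p. 35; Thm. 1.9 p. 37): a REAL
object, Mathlib's relative algebraic closure of `ℚ` in `AlgebraicClosure k`.
[cite: MochizukiAbsTopIII2015, Def 1.7 p.35] -/
def kbarNF (U : M.Curve) : IntermediateField ℚ (AlgebraicClosure (M.base U)) :=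
  algebraicClosure ℚ (AlgebraicClosure (M.base U))

/-! Rmk. 1.7.1 p. 35–36 (record, no claim beyond the definitions): "`X` is an NF-curve if and only
if the `k`-valued point of the moduli stack of hyperbolic curves of type `(g, r)` over `ℚ`
determined by `X` arises, in fact, from a `k̄_NF`-valued point. In particular [...] the descent
data of `X_{k̄}` from `k̄` to `k̄_NF` is unique."  It is this uniqueness that makes
`NFFunctionField` a function of `U` in the model. -/

/-- Prop. 1.4 (i), first clause, relative to `M`: "the inertia group `I_x` of `x` in `Δ_U` is
naturally isomorphic to `Ẑ(1)`" — every cuspidal inertia group of every curve of the model is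
free procyclic (the Galois-module structure `Ẑ(1)` is not typed); as in print (§1 p. 29
"Let `X` be a hyperbolic curve", Prop. 1.4 p. 31 "`U ⊆ X` a nonempty open subscheme") only for
scheme-like `U`, not for orbicurves.  NAMED FACT relative to `M`.
[cite: MochizukiAbsTopIII2015, Prop 1.4 (i) p.31] -/
def Prop_1_4_i (M : CurveModel.{u}) : Prop :=
  ∀ U : M.Curve, M.IsScheme U → (M.cusps U).InertiaFreeProcyclic

/-- Prop. 1.4 (i), second clause, relative to `M`: "the kernels of the natural surjections
`Δ_U ↠ Δ_{U_x}`, `Π_U ↠ Π_{U_x}` are topologically normally generated by the inertia groups of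
points of `U_x ∖ U`" — typed for the cofinite opens of the model: the `Π`-component of `M.res` is
surjective, the `G`-component bijective, and its kernel is the closed normal closure of the
inertia groups of SOME set of cusps of `U` (the model does not record which cusps of `U` lie over
`U' ∖ U`); scheme-like `U`, `U'` only (print: curves, not orbicurves — for an orbicurve removing a
stacky point would make this false).  NAMED FACT relative to `M`.
[cite: MochizukiAbsTopIII2015, Prop 1.4 (i) p.31] -/
def Prop_1_4_i' (M : CurveModel.{u}) : Prop :=
  ∀ (U U' : M.Curve) (h : M.IsCofiniteOpen U U'), M.IsScheme U → M.IsScheme U' →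
    Function.Surjective (M.res h).arith ∧ Function.Bijective (M.res h).gal ∧
      ∃ S : Set (M.cusps U).Cusp,
        (M.res h).arith.toMonoidHom.ker =
          (Subgroup.normalClosure
            (⋃ c ∈ S, ((M.cusps U).Icusp c : Set (M.ext U).arith))).topologicalClosure

/-- Prop. 1.4 (ii), first display, relative to `M`: for `x ∈ X(k) ∖ U(k)`, `U_x := X ∖ {x}` and
`X` proper, "we have a natural exact sequence of profinite groups
`1 → I_x → Δ^{c-cn}_{U_x} → Δ_X → 1`" — for every cofinite open `U_x ⊆ X` of the model with `X`
proper and every RATIONAL cusp `x` of `U_x` whose inertia group generates the cuspidal kernel,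
`IsCuspidallyCentralExtension (M.res h) I_x`.  NAMED FACT relative to `M`; the second half of (ii)
(`M_X := Hom(H²(Δ_X, Ẑ), Ẑ) ≅ I_x` via the Leray differential) is not typed.
[cite: MochizukiAbsTopIII2015, Prop 1.4 (ii) p.31] -/
def Prop_1_4_ii (M : CurveModel.{u}) : Prop :=
  ∀ (Ux X : M.Curve) (h : M.IsCofiniteOpen Ux X), M.IsScheme Ux → M.IsScheme X → M.IsProper X →
    ∀ x : (M.cusps Ux).Cusp, (M.cusps Ux).IsRational x →
      cuspidalKernel (M.res h) =
          (Subgroup.normalClosure ((M.cusps Ux).Icusp x : Set (M.ext Ux).arith)).topologicalClosure →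
        IsCuspidallyCentralExtension (M.res h) ((M.cusps Ux).Icusp x)

/-- Rmk. 1.9.2 p. 38, relative to `M`: "When `k` is an MLF or NF, the 'extension of profinite
groups `1 → Δ_X → Π_X → G_k → 1`' [...] may be replaced by the single profinite group `Π_X`
[cf. [AbsTopI] Thm. 2.6 (v), (vi)]" — every isomorphism of the profinite groups `Π` between two
curves of the model whose base fields are BOTH MLF's ([AbsTopI] Thm. 2.6 (v)) or BOTH NF's (Thm. 2.6
(vi)) carries `Δ` onto `Δ` (the mixed case is not asserted).  NAMED FACT relative to `M`.
[cite: MochizukiAbsTopIII2015, Rmk 1.9.2 p.38] -/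
def Rmk_1_9_2 (M : CurveModel.{u}) : Prop :=
  ∀ X Y : M.Curve,
    (IsMLF (M.base X) ∧ IsMLF (M.base Y)) ∨ (IsNF (M.base X) ∧ IsNF (M.base Y)) →
    ∀ e : (M.ext X).arith ≃ₜ* (M.ext Y).arith,
      (M.ext X).geom.map e.toMonoidHom = (M.ext Y).geom

end CurveModel

end Literature.AnabelianGeometry.AbsoluteAnabelian.AbsTopIII
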